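import Summits.BirchSwinnertonDyer.BirchSwinnertonDyer.Theorems.GenusKolyvaginAtTwoGenusPrimitiveSupplyAtTwoTwistingPrimeDepthEntangled
import Summits.BirchSwinnertonDyer.BirchSwinnertonDyer.Theorems.KolyvaginRoadThreePTDevissageCofinite
import Summits.BirchSwinnertonDyer.Rank1Residual.X11b.BDPRouteLocalNonsingularBridge
import HarnessLib

/-!
# Route `GenusKolyvaginAtTwo`, crux #2 `GenusPrimitiveSupplyAtTwo` (stmt-BirchSwinnertonDyer-22136):
# an ENTANGLED Selmer class of a twist is STRICT at the twisting prime; class-level transport for a congruent pair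
# (§46–§47; the ENTANGLEMENT CRITERION itself is the sequel `…TwistingPrimeEntangledCriterion`, §48)

Width seat `bsd-line-gk2-p4` g10, cell `bsd-f1-sign2`; helper (`--supports stmt-BirchSwinnertonDyer-22136`), §46–§47 of the
twisting-prime series (first of two files). THEOREMS ONLY: no definition, no named fact, no `sorry`; no item is closed; BSD is
not proved by this.

SETTING (row 1 of the supply): `W/ℚ` globally minimal, `Δ_W < 0`, `ρ̄_{W,2}` onto; `K = ℚ(√−ℓ₀)` a PRIME Heegner field of the
supply menu (`ℓ₀` prime, `d_K = −ℓ₀`, all `q ∣ N_W` split, `2` split); `A = Wd` a globally minimal model of `W^{(d_K)}` with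
`#Sel₂(A) = 2`, `P ∈ A(ℚ) ∖ 2A(ℚ)` with a half `Q`. The twin is ENTANGLED when every `h ∈ Γ_{ℚ(E[4])}` fixes `Q`
(⟺ the Kummer class `κ(P)`, i.e. all of `Sel₂(A)`, dies on `Γ_{ℚ(E[4])}`; by `…TwistingPrimeLevelFour` this is the condition
at every level `2^M`).

* §46 `h1Eval_galoisCohomology_map` — `[H¹(φ)x, ρ] = φ[x, ρ]` for an intertwining `φ` of coefficient modules;
  `localization_eq_zero_of_selmer_of_forall_torsionFixing_four_h1Eval_eq_zero` — **an entangled Selmer class of the twist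
  is STRICT at the twisting prime**: for `v` odd, good for `W`, with `v(d)` odd, a class of `Sel₂(Wd)` dying on `Γ_{ℚ(E[4])}`
  has `loc_v = 0` (inertia at `v` fixes `E[4]`, so `loc_v` is unramified — `localization_mem_unramifiedSubgroup_of_forall_inertia`
  — while `𝓛_{Wd}(ℚ_v) ∩ H¹_ur = 0` is the lead's Lemma 2.11, `kummerLocalConditionAt_inf_unramifiedSubgroup_eq_bot_of_twist`).
* §47 CLASS-LEVEL TRANSPORT for the twist pair in X11b currency (`𝓐 = φ_*𝓚_{Wd}` agreeing with `𝓚_W` off `v₀`):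
  `exists_selmer_eq_map_of_localization_eq_zero` (a class of `Sel₂(W)` strict at `v₀` is `H¹(φ)` of a class of `Sel₂(Wd)`:
  `Sel_{v₀} ⊂ H¹_𝓐 = φ_* Sel₂(Wd)`) and `map_mem_selmer_of_localization_eq_zero` (a class of `Sel₂(Wd)` strict at `v₀` maps
  INTO `Sel₂(W)`: `H¹_𝓐 ⊂ Sel^{v₀}` plus `loc_{v₀} = 0`).
* §48 **THE CRITERION** `forall_torsionFixing_four_smul_eq_iff_exists_selmer` (prime Heegner twin over `ℚ`):
  ENTANGLED ⟺ ∃ `y ∈ Sel₂(W)`, `y ≠ 0`, `y` dies on `Γ_{ℚ(E[4])}` AND `y ∈ strictLocalKer W ℚ_{ℓ₀} 2`.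
  So entanglement is NOT a property of the twin alone: it requires that `W`'s own `2`-Selmer group be entangled («one of the
  three non-zero classes of `Sel₂(W)` is the level-`4` inflation class `ξ_W`», at most one by g8's
  `eq_of_forall_torsionFixing_four_h1Eval_eq_zero`), and then happens exactly at the `ℓ₀` where `ξ_W` is strict — a Čebotarev
  condition on `Frob_{ℓ₀}` in `Gal(ℚ(E[4])/ℚ)`. Corollary `exists_torsionFixing_four_smul_ne_of_selmer_disentangled`: **if every
  non-zero class of `Sel₂(W)` survives on `Γ_{ℚ(E[4])}` then NO prime Heegner twin of the menu is entangled** — the twin's point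
  condition of the depth-`M` supply (g8 p623549, g9 p630619, this seat's `…LevelFourTwin`) is then AUTOMATIC for every `K`.

This explains the census (DES13: 2/510 entangled twins): entangled twins occur only under curves `W` whose `Sel₂` contains `ξ_W`.
BSD is not proved by this; U (24947) is untouched.

References: [MazurRubin2010] Def. 3.1, Lemma 2.10–2.11, Prop. 3.3, Remark 2.4; [LawsonWuthrich2016] §3; [GrossLMS1991] §9
Prop. 9.1, 9.6; [SilvermanAEC2009] VII.4.1, X.4; [NeukirchANT1999] II (9.6).
-/

set_option linter.dupNamespace false -- tree convention: `Summit.BirchSwinnertonDyer.BirchSwinnertonDyer.Theorems` (summit = sub-problem)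
set_option autoImplicit false

noncomputable section

open scoped Classical Pointwise ContRepresentation

namespace Summit.BirchSwinnertonDyer.BirchSwinnertonDyer.Theorems.GenusKolyTwistingPrime

open WeierstrassCurve NumberField IsDedekindDomain Field Function
open Literature.NumberTheory.GaloisRepresentations Literature.NumberTheory.EllipticCurves
open Literature.NumberTheory
open Literature.NumberTheory.GaloisRepresentations.DiscreteGaloisModule (SelmerStructure unramifiedSubgroup)
open Literature.NumberTheory.GaloisCohomology
open Summit.BirchSwinnertonDyer.Rank1Residual.X11b.CongruentTransfer
open Summit.BirchSwinnertonDyer.Rank1Residual.X11b.Levels (map_map_eq_self_of_comp_eq)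
open Summit.BirchSwinnertonDyer.Rank1Residual.X11b.KummerPT (kummerStrict kummerRelaxed kummerStrict_of_mem
  kummerStrict_of_not_mem kummerRelaxed_of_mem kummerRelaxed_of_not_mem)
open Rat.HeightOneSpectrum (primesEquiv natGenerator)

universe u

/-! ## §46 Evaluation under change of coefficients; an entangled Selmer class is strict at the twisting prime -/

section Strict

/-- **`[H¹(φ) x, ρ] = φ [x, ρ]`** for an intertwining `φ : E'[n] → E[n]` of coefficient modules and `ρ ∈ Γ_{K(E[n])}`
(on cocycles `H¹(φ)[f] = [φ ∘ f]`, `galoisCohomology.map_one_oneCocycleClass`; the evaluation of a class on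
`Γ_{K(E[n])}` does not depend on the cocycle). [cite: SerreGaloisCohomology1997, I §2.2] [cite: GrossLMS1991, §9] -/
theorem h1Eval_galoisCohomology_map {K : Type u} [Field K] (X' X : WeierstrassCurve K) (n : ℤ)
    (φ : (X'.torsionGaloisModule n).toContRepresentation →ⁱL (X.torsionGaloisModule n).toContRepresentation)
    (x : galH1Torsion X' n) {ρ : absoluteGaloisGroup K} (hρ : ρ ∈ torsionFixing X n) :
    h1Eval X n (galoisCohomology.map φ 1 x) ρ = φ (h1Eval X' n x ρ) := by
  conv_lhs => rw [← oneCocycleClass_reprCocycle X' n x]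
  erw [galoisCohomology.map_one_oneCocycleClass, h1Eval_oneCocycleClass _ n _ hρ, contOneCocycles.pullback_apply]

/-- **AN ENTANGLED SELMER CLASS OF THE TWIST IS STRICT AT THE TWISTING PRIME.** `W/ℚ` elliptic, `Wd` an elliptic model of
`W^{(d)}`, `v` a finite place with `v ∤ 2`, `W` good at `v`, `v(d)` odd (`d = c²π`, `π` a uniformiser), and `4 ∉ v`; `x` a class
of `H¹(ℚ, Wd[2])` satisfying the Kummer condition of `Wd` at `v` and DYING on `Γ_{ℚ(E[4])}` (`E = W`). Then `loc_v x = 0`.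
Proof: the inertia group at `v` fixes `E[4]` (`inertia_le_torsionFixing`: good reduction, `v ∤ 4`), so the cocycle of `x`
vanishes on it and `loc_v x ∈ H¹_ur(ℚ_v, Wd[2])` (`localization_mem_unramifiedSubgroup_of_forall_inertia`); but
`𝓛_{Wd}(ℚ_v) ∩ H¹_ur = 0` at a prime ramified in the twist (the lead's Mazur–Rubin Lemma 2.11,
`kummerLocalConditionAt_inf_unramifiedSubgroup_eq_bot_of_twist`). [cite: MazurRubin2010, Lemma 2.11 (arXiv:0904.3709 p. 7)]
[cite: SilvermanAEC2009, Prop. VII.4.1] [cite: NeukirchANT1999, Ch. II §9 Prop. (9.6)] -/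
theorem localization_eq_zero_of_kummer_of_forall_torsionFixing_four_h1Eval_eq_zero
    (W : WeierstrassCurve ℚ) [W.IsElliptic] {d : ℚ} (hd : d ≠ 0) {Wd : WeierstrassCurve ℚ} [Wd.IsElliptic]
    {C : VariableChange ℚ} (hWd : C • W.quadraticTwist d = Wd)
    (v : HeightOneSpectrum (𝓞 ℚ)) (h2v : ((2 : ℕ) : 𝓞 ℚ) ∉ v.asIdeal) (h4v : ((4 : ℤ) : 𝓞 ℚ) ∉ v.asIdeal)
    (hW : W.HasGoodReductionAt v) (hram : ∃ π c : ℚ, v.valuation ℚ π = WithZero.exp (-1 : ℤ) ∧ d = c ^ 2 * π)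
    {x : galoisCohomology (Wd.torsionGaloisModule ((2 : ℕ) : ℤ)) 1}
    (hxv : galoisCohomology.localization (Wd.torsionGaloisModule ((2 : ℕ) : ℤ)) (Sum.inr v) 1 x ∈
      Wd.kummerLocalConditionAt ((2 : ℕ) : ℤ) (v.adicCompletion ℚ))
    (hx : ∀ h ∈ torsionFixing W (4 : ℤ), h1Eval Wd ((2 : ℕ) : ℤ) x h = 0) :
    galoisCohomology.localization (Wd.torsionGaloisModule ((2 : ℕ) : ℤ)) (Sum.inr v) 1 x = 0 := by
  -- inertia at `v` fixes `E[4]`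
  have hvbad : v ∉ W.badPlaces (𝓞 ℚ) := fun h ↦ h hW
  obtain ⟨𝔐, h𝔐⟩ := v.localPrimesAbove_nonempty
  have hI : (adicCompletionPrime ℚ v).inertia (absoluteGaloisGroup ℚ) ≤ torsionFixing W (4 : ℤ) := by
    rw [← Summit.BirchSwinnertonDyer.Rank1Residual.X11b.AcSelmer.primeBelow_closureEmb_eq_adicCompletionPrime v h𝔐]
    exact inertia_le_torsionFixing W hvbad h4v _ h𝔐
  -- the cocycle of `x` vanishes on inertia, so `loc_v x` is unramified
  have hur : galoisCohomology.localization (Wd.torsionGaloisModule ((2 : ℕ) : ℤ)) (Sum.inr v) 1 x ∈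
      unramifiedSubgroup (GaloisRep.toLocal v (Wd.torsionGaloisModule ((2 : ℕ) : ℤ))) 1 := by
    have h := KolyvaginRoadThreePT.localization_mem_unramifiedSubgroup_of_forall_inertia
      (Wd.torsionGaloisModule ((2 : ℕ) : ℤ)) (reprCocycle Wd ((2 : ℕ) : ℤ) x) v (fun g hg ↦ hx g (hI hg))
    have e : oneCocycleClass (Wd.torsionGaloisModule ((2 : ℕ) : ℤ)).toTopRep (reprCocycle Wd ((2 : ℕ) : ℤ) x) = x :=
      oneCocycleClass_reprCocycle Wd ((2 : ℕ) : ℤ) x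
    rw [e] at h
    exact h
  -- transversality at the ramified prime
  have hbot := GenusKolyTwistRamified.kummerLocalConditionAt_inf_unramifiedSubgroup_eq_bot_of_twist W hd hWd v h2v hW
    hram (k := 1) le_rfl
  rw [pow_one] at hbot
  have hmem := hbot.le (AddSubgroup.mem_inf.mpr ⟨hxv, hur⟩)
  exact AddSubgroup.mem_bot.mp hmem

/-- **`loc_v y = 0` ⟹ `y ∈ strictLocalKer W ℚ_p 2`** (`p` the prime under `v`): X11b's genuine localisation at `v` versus
Mazur–Rubin's strict local kernel at `ℚ_p` (gk2-p5's `mem_torsionLocalKer_iff_localization_eq_zero_rat` + `ℚ_v ≃ ℚ_p`).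
[cite: MazurRubin2010, Def. 3.1] [cite: McCallumLMS1991, §3 (3)] -/
theorem mem_strictLocalKer_of_localization_eq_zero (W : WeierstrassCurve ℚ) [W.IsElliptic]
    (v : HeightOneSpectrum (𝓞 ℚ)) {y : galoisCohomology (W.torsionGaloisModule ((2 : ℕ) : ℤ)) 1}
    (hy : galoisCohomology.localization (W.torsionGaloisModule ((2 : ℕ) : ℤ)) (Sum.inr v) 1 y = 0) :
    haveI := Fact.mk (primesEquiv v).2
    y ∈ MazurRubin2010.strictLocalKer W ℚ_[((primesEquiv v : Nat.Primes) : ℕ)] ((2 : ℕ) : ℤ) := by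
  haveI := Fact.mk (primesEquiv v).2
  letI : Algebra ℚ (v.adicCompletion ℚ) := inferInstance
  haveI : CharZero (v.adicCompletion ℚ) := Literature.NumberTheory.GaloisRepresentations.charZero_adicCompletion v
  have h1 : y ∈ W.torsionLocalKer (v.adicCompletion ℚ) ((2 : ℕ) : ℤ) :=
    (GenusKolyTwistLocal.mem_torsionLocalKer_iff_localization_eq_zero_rat W v y).mpr hy
  exact (mem_torsionLocalKer_padic_iff W
    (RingEquivClass.toRingEquiv (Rat.HeightOneSpectrum.adicCompletion.padicEquiv (R := 𝓞 ℚ) v)) ((2 : ℕ) : ℤ) y).mpr h1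

/-- **`y ∈ strictLocalKer W ℚ_p 2` ⟹ `loc_v y = 0`** (converse bookkeeping). [cite: MazurRubin2010, Def. 3.1]
[cite: McCallumLMS1991, §3 (3)] -/
theorem localization_eq_zero_of_mem_strictLocalKer (W : WeierstrassCurve ℚ) [W.IsElliptic]
    (v : HeightOneSpectrum (𝓞 ℚ)) {y : galoisCohomology (W.torsionGaloisModule ((2 : ℕ) : ℤ)) 1}
    (hy : haveI := Fact.mk (primesEquiv v).2
      y ∈ MazurRubin2010.strictLocalKer W ℚ_[((primesEquiv v : Nat.Primes) : ℕ)] ((2 : ℕ) : ℤ)) :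
    galoisCohomology.localization (W.torsionGaloisModule ((2 : ℕ) : ℤ)) (Sum.inr v) 1 y = 0 := by
  haveI := Fact.mk (primesEquiv v).2
  letI : Algebra ℚ (v.adicCompletion ℚ) := inferInstance
  haveI : CharZero (v.adicCompletion ℚ) := Literature.NumberTheory.GaloisRepresentations.charZero_adicCompletion v
  have h1 : y ∈ W.torsionLocalKer (v.adicCompletion ℚ) ((2 : ℕ) : ℤ) :=
    (mem_torsionLocalKer_padic_iff W
      (RingEquivClass.toRingEquiv (Rat.HeightOneSpectrum.adicCompletion.padicEquiv (R := 𝓞 ℚ) v)) ((2 : ℕ) : ℤ) y).mp hy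
  exact (GenusKolyTwistLocal.mem_torsionLocalKer_iff_localization_eq_zero_rat W v y).mp h1

end Strict

/-! ## §47 Class-level transport for a congruent pair agreeing off one place -/

section Transport

variable {K : Type} [Field K] [NumberField K] (W Y : WeierstrassCurve K) (p : ℕ)

/-- **A Selmer class of `E` strict at `v₀` is the transport of a Selmer class of `Y`.** For a congruent pair with inverse
intertwining maps `φ : Y[p] ⇄ E[p] : ψ`, the transported structure `𝓐 = φ_*𝓚_Y` agreeing with `𝓚_E` off `v₀`, and
`y ∈ Sel^{(p)}(E)` with `loc_{v₀} y = 0`: `y = H¹(φ) c` for some `c ∈ Sel^{(p)}(Y)` (`y ∈ Sel_{v₀} ⊂ H¹_𝓐 = φ_* Sel(Y)`).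
[cite: MazurRubin2010, Def. 3.1 and Prop. 3.3 (first display of the proof) (arXiv:0904.3709 pp. 9–10)] -/
theorem exists_selmer_eq_map_of_localization_eq_zero
    (φ : (Y.torsionGaloisModule (p : ℤ)).toContRepresentation →ⁱL (W.torsionGaloisModule (p : ℤ)).toContRepresentation)
    (ψ : (W.torsionGaloisModule (p : ℤ)).toContRepresentation →ⁱL (Y.torsionGaloisModule (p : ℤ)).toContRepresentation)
    (hψφ : ∀ a, ψ (φ a) = a) (hφψ : ∀ b, φ (ψ b) = b)
    (𝓐 : SelmerStructure (W.torsionGaloisModule (p : ℤ)))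
    (h𝓐 : ∀ v, 𝓐 v = (Y.kummerSelmerStructure (p : ℤ) v).map
      (galoisCohomology.map (φ.restrictField (Place.Completion v)) 1))
    (v₀ : HeightOneSpectrum (𝓞 K))
    (hagree : ∀ v : Place K, v ≠ Sum.inr v₀ → 𝓐 v = W.kummerSelmerStructure (p : ℤ) v)
    {y : galoisCohomology (W.torsionGaloisModule (p : ℤ)) 1} (hy : y ∈ (W.kummerSelmerStructure (p : ℤ)).selmerGroup)
    (hy0 : galoisCohomology.localization (W.torsionGaloisModule (p : ℤ)) (Sum.inr v₀) 1 y = 0) :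
    ∃ c ∈ (Y.kummerSelmerStructure (p : ℤ)).selmerGroup, galoisCohomology.map φ 1 c = y := by
  set S : Finset (Place K) := {(Sum.inr v₀ : Place K)} with hSdef
  have hagreeS : ∀ v ∉ S, 𝓐 v = W.kummerSelmerStructure (p : ℤ) v := fun v hv ↦
    hagree v (by simpa [hSdef] using hv)
  have hyS : y ∈ (kummerStrict W p S).selmerGroup :=
    GenusKolyTwistLocal.mem_selmerGroup_kummerStrict_of_forall_localization_eq_zero W p S hy fun v hv ↦ by
      have hv' : v = Sum.inr v₀ := by simpa [hSdef] using hv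
      subst hv'
      exact hy0
  have hy𝓐 : y ∈ 𝓐.selmerGroup := (selmerGroup_sandwich_of_agree W p S hagreeS).1 hyS
  rw [selmerGroup_eq_map_of_transport (Y.kummerSelmerStructure (p : ℤ)) φ ψ hψφ hφψ 𝓐 h𝓐] at hy𝓐
  obtain ⟨c, hc, hcy⟩ := AddSubgroup.mem_map.mp hy𝓐
  exact ⟨c, hc, hcy⟩

/-- **A Selmer class of `Y` strict at `v₀` transports INTO `Sel^{(p)}(E)`.** Same frame; for `c ∈ Sel^{(p)}(Y)` with
`loc_{v₀} c = 0`: `H¹(φ) c ∈ Sel^{(p)}(E)` and `loc_{v₀}(H¹(φ) c) = 0` (`H¹(φ) c ∈ H¹_𝓐 ⊂ Sel^{v₀}`, the relaxed structure,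
and localisation commutes with `H¹(φ)`). [cite: MazurRubin2010, Def. 3.1 and Prop. 3.3 (arXiv:0904.3709 pp. 9–10)] -/
theorem map_mem_selmer_of_localization_eq_zero
    (φ : (Y.torsionGaloisModule (p : ℤ)).toContRepresentation →ⁱL (W.torsionGaloisModule (p : ℤ)).toContRepresentation)
    (𝓐 : SelmerStructure (W.torsionGaloisModule (p : ℤ)))
    (h𝓐 : ∀ v, 𝓐 v = (Y.kummerSelmerStructure (p : ℤ) v).map
      (galoisCohomology.map (φ.restrictField (Place.Completion v)) 1))
    (v₀ : HeightOneSpectrum (𝓞 K))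
    (hagree : ∀ v : Place K, v ≠ Sum.inr v₀ → 𝓐 v = W.kummerSelmerStructure (p : ℤ) v)
    {c : galoisCohomology (Y.torsionGaloisModule (p : ℤ)) 1} (hc : c ∈ (Y.kummerSelmerStructure (p : ℤ)).selmerGroup)
    (hc0 : galoisCohomology.localization (Y.torsionGaloisModule (p : ℤ)) (Sum.inr v₀) 1 c = 0) :
    galoisCohomology.map φ 1 c ∈ (W.kummerSelmerStructure (p : ℤ)).selmerGroup ∧
      galoisCohomology.localization (W.torsionGaloisModule (p : ℤ)) (Sum.inr v₀) 1 (galoisCohomology.map φ 1 c) = 0 := by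
  set S : Finset (Place K) := {(Sum.inr v₀ : Place K)} with hSdef
  have hagreeS : ∀ v ∉ S, 𝓐 v = W.kummerSelmerStructure (p : ℤ) v := fun v hv ↦
    hagree v (by simpa [hSdef] using hv)
  have hloc0 : galoisCohomology.localization (W.torsionGaloisModule (p : ℤ)) (Sum.inr v₀) 1
      (galoisCohomology.map φ 1 c) = 0 := by
    rw [localization_map, hc0]
    exact map_zero _
  have h𝓐c : galoisCohomology.map φ 1 c ∈ 𝓐.selmerGroup :=
    map_selmerGroup_le_of_transport (Y.kummerSelmerStructure (p : ℤ)) φ 𝓐 h𝓐 (AddSubgroup.mem_map_of_mem _ hc)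
  have hrel : galoisCohomology.map φ 1 c ∈ (kummerRelaxed W p S).selmerGroup :=
    (selmerGroup_sandwich_of_agree W p S hagreeS).2 h𝓐c
  refine ⟨?_, hloc0⟩
  rw [SelmerStructure.mem_selmerGroup_iff] at hrel ⊢
  intro v
  by_cases hv : v ∈ S
  · have hv' : v = Sum.inr v₀ := by simpa [hSdef] using hv
    subst hv'
    rw [hloc0]
    exact zero_mem _
  · have h := hrel v
    rw [kummerRelaxed_of_not_mem W p S hv] at h
    exact h

end Transport
end Summit.BirchSwinnertonDyer.BirchSwinnertonDyer.Theorems.GenusKolyTwistingPrime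

end
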